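import Literature.MathematicalPhysics.QuantumFieldTheory.Balaban1983to89.Node00.Record12ContT
import Literature.MathematicalPhysics.QuantumFieldTheory.Balaban1983to89.B12SmallFieldDomain259
import Literature.MathematicalPhysics.QuantumFieldTheory.Balaban1983to89.T4ExpWindowSmallField

/-!
# NODE 00 (YM-PLAN Track A) — [I] (2.9)'s FLUCTUATION characteristic function `χ_k` READ ON THE FIBRE as a density on the step-`k` field:
# the critical configuration `V^{(k)}(W) = M^k(U_{k+1}(W))` of (2.3), `χ^{(2.9)}_k(V) = Π_{b∉{b₀(c)}} χ({|V(b)·V^{(k)}(V̄)(b)⁻¹ − 1| < ε₁})`,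
# its ALL-BONDS twin, the β-slot re-keying, the THRESHOLD-HIERARCHY lemma «χ^{(2.9)}_k = 1 ⇒ V ∈ domAlt_k», and the re-keyed β-version provisos (OFFERED)

Cell `pub-ymgap`, NODE 00, seat `pub-ymgap-node00-def-K0e` g3 (prover, K0′ row P7 `contT`; located note `P7-LOCATOR-AUDIT.md`, evidence #5 on
stmt-QuantumFields-19902).  [I] = [Balaban1987RG1] (CMP 109), [III] = [Balaban1988Convergent] (CMP 119).  APPEND-ONLY GROWTH: a NEW importing module
(def-χ's `Node00/SmallFieldChiFixedOfRecord.lean`, lit-balaban r09's `B12SmallFieldDomain259`, node00-def-B's `Uk`, FILE 1 `Node00/Record12ContT` are CITED BY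
NAME, nothing landed is edited).  KNIT-BY-NAME; count-neutral; NOTHING of Bałaban's asserted; NOT a discharge of `contT` in any form.

WHY (the seat's located finding L-K0e-5).  The β-layer of record reads `A_{k+1} = log(𝐍_k⁻¹·T_k(χ_k e^{−GF/g_k²+A_k}))` ([I] (0.19)) with the χ slot
filled by def-χ's `chiFixed7 ν K g k = chiFixAltOfRecord ν K k` = the INDICATOR of the small-field DOMAIN «|∂V − 1| < ε₀ on T₁^{(k)}» of [I] p. 259 —
in print the domain of the VARIABLE of `A_k` (Thm 1 p. 259: «the effective actions for small fields»).  The characteristic function print INTEGRATES in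
(0.19)∕(2.1) is a different object: [I] p. 256 l. 6 «The characteristic function χ_k restricts the integral to small fluctuation fields»; (2.1) p. 265
«we assume that the characteristic function χ_k and the δ-functions in (2.1) restrict the variables B′ = (1∕i) log V′ [V′ = V(V^{(k)})⁻¹] to a sufficiently
small neighborhood of 0»; (2.9) p. 266 «χ_k = Π_{b∈T^{(k)}∖{b₀(c): c∈T^{(k+1)}}} χ({|B′(b)| < ε₁})», with `V^{(k)} = V^{(k)}(W) = M^k(U_{k+1}(W))` the critical
configuration OVER THE NEW FIELD `W` ((2.2)–(2.3) p. 265).  def-χ recorded the keying as interim (`SmallFieldChiFixedOfRecord` header: «TODO([I] (2.9)):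
`chiFix29OfRecord ε₁ K k := Π_b 𝟙{‖B′(b)‖ < ε₁}` once the chart lands»).  THIS FILE TYPES (2.9) WITHOUT WAITING FOR A LOG CHART: on the fibre of the
averaging the new field IS `W = V̄`, so `χ_k` is a function of `V` alone, and «|B′(b)| < ε₁» is read in the group as «|V(b)·V^{(k)}(V̄)(b)⁻¹ − 1| < ε₁»
(`dist1`, the tree's B7 (19) operator norm; for `B′(b) = (1∕i) log V′(b)` Hermitian, `|V′(b) − 1| = 2 sin(|B′(b)|∕2)`, so the two cutoffs define the same
family of sets under the monotone reparametrisation `ε₁ ↦ 2 sin(ε₁∕2)` of the threshold — a FIXED constant either way, [I] Thm 3 p. 264).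

WHAT IS DEFINED ∕ PROVED (definitions with bodies, TOTAL; theorems = bookkeeping + ONE group-algebra lemma; 0 `sorry` ∕ `instance` ∕ `notation`):
* §1 `critCfgOfRecord ν K k W := M^k(U_{k+1}(W))` — (2.3) `V^{(k)}(W) = Ū^k_{k+1} = M^k(U_{k+1})` over node00-def-B's background of record `Uk F N K (k+1) ν.εreg`
  and the averaging of record (`Averaging.iter (avOfRecord F N K) k`); `avg_critCfgOfRecord` — ON THE SOLVABLE SET `V^{(k)}(W)` LIES IN THE FIBRE OVER `W`
  (`M(V^{(k)}(W)) = W`, the identity behind (2.4) «M(VV^{(k)})M(V^{(k)})⁻¹ = exp iQ(B′)»); the junk corner off the solvable set (`Uk = 1`) displayed.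
* §2 `fluctDevOfRecord ν K k V b := dist1 (V^{(k)}(V̄)(b)⁻¹ · V(b))` (= `dist1 (V(b)·V^{(k)}(V̄)(b)⁻¹)`, `fluctDevOfRecord_eq_dist1_mul_inv`) — «|V′(b) − 1|» ON THE
  FIBRE; **`chiFix29OfRecord ν ε₁ K k`** = (2.9) AS PRINTED (bonds `b₀(c)` EXCLUDED, lit-balaban's `B12SmallFieldDomain259.b0`) and **`chiFix29AllOfRecord`** (all
  bonds; `≤ chiFix29OfRecord`); faces `_eq_zero_or_one ∕ _nonneg ∕ _le_one ∕ _eq_one_iff`; **`chiFix29OfRecord_eq_chiFluctPrinted`** — it IS r09's typed (2.9)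
  `B12SmallFieldDomain259.chiFluctPrinted ε₁` evaluated at the deviation profile `b ↦ |V′(b) − 1|` (and `chiFix29AllOfRecord = chiFluct ε₁ ∘ …`): the record's
  χ^{(2.9)} is the lit-balaban object read on the fibre, not a restatement; `measurable_chiFix29AllOfRecord_of ∕ measurable_chiFix29OfRecord_of` — measurable AS
  SOON AS `W ↦ U_{k+1}(W)` is (the (H-U) species of K0c ∕ def-R: a bare `Classical.choose` minimiser has no measurability theorem; DISPLAYED, not asserted).
* §3 the β-SLOT RE-KEYING `chiFixed29 ν ε₁ : (K : ℕ) → (ℕ → ℝ) → (k : ℕ) → Density (F.P K) k (SU N)` (same TYPE as `chiFixed7`∕`chi7`; coupling-blind, `rfl`)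
  and **THE THRESHOLD-HIERARCHY LEMMA** `mem_domAltOfRecord_of_chiFix29All_eq_one`: if `χ^{(2.9),all}_k(V) = 1`, the critical configuration over `V̄` has
  `δ`-small plaquettes and `δ + 4ε₁ ≤ ε₀`, then `V ∈ domAltOfRecord ν K k` — by the tree's own group algebra (`T4ExpWindowSmallField.dist1_plaqHol_le_add`,
  `plaqDev_le_four_mul`: |∂V − 1| ≤ |∂V^{(k)} − 1| + Σ_{b⊂∂p}|V^{(k)}(b)⁻¹V(b) − 1|; [IV] Prop 1 (1.78) ∕ [III] p. 265 l. 31–32 «on Ω^∼_{k+1} the functions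
  χ_{Λ_k} and χ_k are equal to 1»); product form `chiFixAltOfRecord_mul_chiFix29All` — THE SHARP DOMAIN INDICATOR OF RECORD IS INVISIBLE on the support of the
  fluctuation cutoff (the mechanism by which print never integrates an old `χ_k` across a fibre in a small-field term); printed form
  `mem_domAltOfRecord_of_chiFix29_eq_one` MODULO the p. 266–267 rider on the excluded variables `B′(b₀(c))` («restrictions … with the constant ε₁ replaced by
  O(ε₁)», `B12B0Restriction267`) as a displayed bond hypothesis.  The Prop-2 [12] smallness of `∂V^{(k)}(W)` for regular `W` is a HYPOTHESIS (`hcrit`), never asserted.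
* §4 OFFERED (no record predicate defined; the ₁₀∕₁₂∕₁₃ owner decides): the χ-GENERIC β-input `betaInputOfRecord T χ K g k` (FILE 1's ∕ def-T's (0.19) density with
  the χ family a parameter; `rfl` at `chiFixed7`), the χ-generic on-domain proviso `HasContTransportAlongOnχ T χ dom` (FILE 1's `Stage8Params.HasContTransportAlongOn θ T dom` IS it at
  `χ := chiFixed7 θ.ν`, `Iff.rfl`; def-T's `HasContTransportAlong` at `dom := univ`), and the (2.9)-keyed provisos `HasContTransportAlong29` (everywhere) ∕ **`HasContTransportAlongDom29`** (on def-R's FIRST-form domain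
  `domOfRecord ν K (k+1)` = print's «W regular: U_{k+1}(W) ∈ U_{k+1}(ε₀)», (2.1) p. 265) — the proviso whose small-field content IS [I] (2.10) p. 267 + §3 ∕ [III]
  (2.23)(ii) MODULO the Jacobian face of (0.4)'s disintegration (located note §4 (F1): `transportOfRecord` is the abstract `rnDeriv × condKernel` transform; print's
  «∫dV δ(V̄W⁻¹) … = ∫dB′ σ(B′) δ(Q(B′)) …» is used there without proof).  DISPLAYED, never asserted.

HONEST FRAMING: definitions of record + kernel bookkeeping (`rfl`∕`Iff.rfl`, indicator algebra, one `dist1` estimate from the tree); nothing of Bałaban's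
asserted ([B11] Thm 1 existence, Prop 2 [12], Thm 3's restrictions on ε₀, ε₁ all stay hypotheses or docstring locators); counts unmoved (typed 28∕28 · discharged
5∕28); P7 NOT discharged; adopting `chiFixed29` in a record is a β-OF-RECORD change (K1′–K3′ read β) and is NOT proposed here — this file prices it.  One finite
four-torus programme at fixed `ε = L^{−K}` — NOT continuum ∕ ℝ⁴ ∕ OS ∕ mass gap ∕ Clay.  No `sorry`, no `axiom`, no `instance`, no `notation`.
-/

noncomputable section

open MeasureTheory Set

namespace Literature.MathematicalPhysics.QuantumFieldTheory.Balaban1983to89.Node00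

open T4Continuum (T4Family)
open B12Eq019ActionBody (integrand)
open T4TiltOscillation (bdev)
open T4ExpWindowSmallField (plaqDev plaqDev_le_four_mul dist1_plaqHol_le_add)

variable (F : T4Family) (N : ℕ) [NeZero N]

/-! ## §1. (2.3) p. 265: the critical configuration `V^{(k)}(W) = M^k(U_{k+1}(W))` of record -/

/-- **The critical configuration of record** `V^{(k)}(W)` — [I] (2.3) p. 265: *«This critical configuration, which is a minimum of the function (2.2), is denoted
by V^{(k)} = V^{(k)}(W), and is related to the minimal configuration U_{k+1}(W) in the axial gauge by the equality V^{(k)} = Ū^k_{k+1} = M^k(U_{k+1}). (2.3)»* —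
over node00-def-B's background of record `U_{k+1}(W) = Uk F N K (k+1) ν.εreg W` (a TOTAL chosen minimiser; [B11] Thm 1 NOT asserted) and the averaging of record.
[cite: Balaban1987RG1, (2.3) p.265] -/
def critCfgOfRecord (ν : Stage7Numerics) (K k : ℕ) (W : GaugeField (F.P K) (k + 1) (SU N)) : GaugeField (F.P K) k (SU N) :=
  Averaging.iter (avOfRecord F N K) k (Uk F N K (k + 1) ν.εreg W)

variable {F N}

/-- Unfolding (`rfl`). [cite: Balaban1987RG1, (2.3) p.265 (bookkeeping)] -/
theorem critCfgOfRecord_def (ν : Stage7Numerics) (K k : ℕ) (W : GaugeField (F.P K) (k + 1) (SU N)) :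
    critCfgOfRecord F N ν K k W = Averaging.iter (avOfRecord F N K) k (Uk F N K (k + 1) ν.εreg W) := rfl

/-- **`V^{(k)}(W)` LIES IN THE FIBRE OVER `W`**: on node00-def-B's solvable set, `M(V^{(k)}(W)) = W` (one more averaging of (2.3) is `Ū^{k+1}_{k+1} = W`,
`Node00.iter_Uk`) — the identity behind (2.4) p. 266 «M(VV^{(k)})M(V^{(k)})⁻¹ = exp iQ(B′)». [cite: Balaban1987RG1, (2.3)–(2.4) pp.265–266] -/
theorem avg_critCfgOfRecord {ν : Stage7Numerics} {K k : ℕ} {W : GaugeField (F.P K) (k + 1) (SU N)} (h : UkExists F N K (k + 1) ν.εreg W) :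
    (avOfRecord F N K k).avg (critCfgOfRecord F N ν K k W) = W := by
  have h' := iter_Uk h
  exact h'

/-- The documented JUNK CORNER: off the solvable set `U_{k+1}(W) = 1`, so `V^{(k)}(W) = M^k(1)` (node00-def-B's default; print's objects are meant on the
solvable set, [B11] Thm 1). [cite: Balaban1987RG1, (2.3) p.265 (typing convention)] -/
theorem critCfgOfRecord_of_not {ν : Stage7Numerics} {K k : ℕ} {W : GaugeField (F.P K) (k + 1) (SU N)} (h : ¬ UkExists F N K (k + 1) ν.εreg W) :
    critCfgOfRecord F N ν K k W = Averaging.iter (avOfRecord F N K) k 1 := by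
  rw [critCfgOfRecord_def, Uk_of_not h]

/-- `W ↦ V^{(k)}(W)` is measurable AS SOON AS `W ↦ U_{k+1}(W)` is (every averaging map of record is measurable, `avOfRecord_measurable`).  The hypothesis is the
(H-U) species (a measurable selection of minimisers is not a tree theorem); DISPLAYED. [cite: Balaban1987RG1, (2.3) p.265 (bookkeeping)] -/
theorem measurable_critCfgOfRecord_of {ν : Stage7Numerics} {K k : ℕ} (hU : Measurable (Uk F N K (k + 1) ν.εreg)) :
    Measurable (critCfgOfRecord F N ν K k) := by
  have hiter : ∀ j : ℕ, Measurable (Averaging.iter (avOfRecord F N K) j) := by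
    intro j
    induction j with
    | zero => exact measurable_id
    | succ j ih => exact (avOfRecord_measurable F N K j).comp ih
  exact (hiter k).comp hU

variable (F N)

/-! ## §2. (2.9) p. 266 read on the fibre: the fluctuation deviation and the characteristic functions `χ^{(2.9)}_k` of record -/

/-- **THE FLUCTUATION DEVIATION at a bond, read on the fibre** `W = V̄`: `|V′(b) − 1|` for print's `V′ = V(V^{(k)})⁻¹` ((2.1) p. 265), in the tree's `bdev`
orientation `dist1 (V^{(k)}(V̄)(b)⁻¹ · V(b))` (the two orientations have the same `dist1`, `fluctDevOfRecord_eq_dist1_mul_inv`).  Print's variable is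
`B′(b) = (1∕i) log V′(b)`; «|B′(b)| < ε₁» and «|V′(b) − 1| < 2 sin(ε₁∕2)» cut the same sets. [cite: Balaban1987RG1, (2.1) p.265 and (2.9) p.266] -/
def fluctDevOfRecord (ν : Stage7Numerics) (K k : ℕ) (V : GaugeField (F.P K) k (SU N)) (b : PBond (F.P K) k) : ℝ :=
  dist1 (bdev V (critCfgOfRecord F N ν K k ((avOfRecord F N K k).avg V)) b)

variable {F N}

/-- Unfolding: `fluctDevOfRecord … V b = dist1 (V^{(k)}(V̄)(b)⁻¹ * V b)` (`rfl`). [cite: Balaban1987RG1, (2.9) p.266 (bookkeeping)] -/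
theorem fluctDevOfRecord_apply (ν : Stage7Numerics) (K k : ℕ) (V : GaugeField (F.P K) k (SU N)) (b : PBond (F.P K) k) :
    fluctDevOfRecord F N ν K k V b = dist1 ((critCfgOfRecord F N ν K k ((avOfRecord F N K k).avg V) b)⁻¹ * V b) := rfl

/-- Print's orientation: `|V(b)·V^{(k)}(b)⁻¹ − 1|` equals the `bdev` reading (B7 (19): `|g⁻¹ − 1| = |g − 1|`, `|hgh⁻¹ − 1| = |g − 1|`).
[cite: Balaban1987RG1, (2.1) p.265 (bookkeeping)] -/
theorem fluctDevOfRecord_eq_dist1_mul_inv (ν : Stage7Numerics) (K k : ℕ) (V : GaugeField (F.P K) k (SU N)) (b : PBond (F.P K) k) :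
    fluctDevOfRecord F N ν K k V b = dist1 (V b * (critCfgOfRecord F N ν K k ((avOfRecord F N K k).avg V) b)⁻¹) := by
  rw [fluctDevOfRecord_apply]
  set V₀ := critCfgOfRecord F N ν K k ((avOfRecord F N K k).avg V) b
  have hconj : V b * V₀⁻¹ = V₀ * (V₀⁻¹ * V b) * V₀⁻¹ := by group
  rw [hconj, GaugeGroup.dist1_conj]

/-- `0 ≤ |V′(b) − 1|`. [cite: Balaban1987RG1, (2.9) p.266 (bookkeeping)] -/
theorem fluctDevOfRecord_nonneg (ν : Stage7Numerics) (K k : ℕ) (V : GaugeField (F.P K) k (SU N)) (b : PBond (F.P K) k) :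
    0 ≤ fluctDevOfRecord F N ν K k V b :=
  GaugeGroup.dist1_nonneg _

/-- A bond of `T^{(k)}` is one of the DISTINGUISHED bonds `b₀(c)`, `c ∈ T^{(k+1)}`, of [I] p. 267 (lit-balaban's `B12SmallFieldDomain259.b0`) — the variables
(2.9) does NOT restrict. [cite: Balaban1987RG1, (2.9) p.266 and p.267] -/
def IsB0 {K k : ℕ} (b : PBond (F.P K) k) : Prop :=
  ∃ c : PBond (F.P K) (k + 1), B12SmallFieldDomain259.b0 c = b

variable (F N)

open Classical in
/-- **`χ^{(2.9)}_k` OF RECORD, AS PRINTED** — [I] (2.9) p. 266: *«Finally we can define the characteristic function χ_k = Π_{b∈T^{(k)}∖{b₀(c): c∈T^{(k+1)}}}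
χ({|B′(b)| < ε₁})»*, read ON THE FIBRE `W = V̄` as a 0∕1 density on the step-`k` field: `1` iff `|V(b)·V^{(k)}(V̄)(b)⁻¹ − 1| < ε₁` at every bond except the
distinguished `b₀(c)`.  def-χ's TODO name. [cite: Balaban1987RG1, (2.9) p.266] -/
def chiFix29OfRecord (ν : Stage7Numerics) (ε₁ : ℝ) (K k : ℕ) : Density (F.P K) k (SU N) :=
  fun V => if ∀ b : PBond (F.P K) k, ¬ IsB0 b → fluctDevOfRecord F N ν K k V b < ε₁ then 1 else 0

open Classical in
/-- **The ALL-BONDS twin** `Π_{b∈T^{(k)}} χ({|V′(b) − 1| < ε₁})` (lit-balaban's `chiFluct` read on the fibre; print restricts the `b₀(c)`-variables only through the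
p. 266–267 rider). [cite: Balaban1987RG1, (2.9) p.266] -/
def chiFix29AllOfRecord (ν : Stage7Numerics) (ε₁ : ℝ) (K k : ℕ) : Density (F.P K) k (SU N) :=
  fun V => if ∀ b : PBond (F.P K) k, fluctDevOfRecord F N ν K k V b < ε₁ then 1 else 0

variable {F N}

/-- `χ^{(2.9)} ∈ {0, 1}`. [cite: Balaban1987RG1, (2.9) p.266 (bookkeeping)] -/
theorem chiFix29OfRecord_eq_zero_or_one (ν : Stage7Numerics) (ε₁ : ℝ) (K k : ℕ) (V : GaugeField (F.P K) k (SU N)) :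
    chiFix29OfRecord F N ν ε₁ K k V = 0 ∨ chiFix29OfRecord F N ν ε₁ K k V = 1 := by
  unfold chiFix29OfRecord
  split_ifs
  · exact Or.inr rfl
  · exact Or.inl rfl

/-- `χ^{(2.9),all} ∈ {0, 1}`. [cite: Balaban1987RG1, (2.9) p.266 (bookkeeping)] -/
theorem chiFix29AllOfRecord_eq_zero_or_one (ν : Stage7Numerics) (ε₁ : ℝ) (K k : ℕ) (V : GaugeField (F.P K) k (SU N)) :
    chiFix29AllOfRecord F N ν ε₁ K k V = 0 ∨ chiFix29AllOfRecord F N ν ε₁ K k V = 1 := by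
  unfold chiFix29AllOfRecord
  split_ifs
  · exact Or.inr rfl
  · exact Or.inl rfl

/-- `0 ≤ χ^{(2.9)} ≤ 1`. [cite: Balaban1987RG1, (2.9) p.266 (bookkeeping)] -/
theorem chiFix29OfRecord_mem_Icc (ν : Stage7Numerics) (ε₁ : ℝ) (K k : ℕ) (V : GaugeField (F.P K) k (SU N)) :
    chiFix29OfRecord F N ν ε₁ K k V ∈ Icc (0 : ℝ) 1 := by
  rcases chiFix29OfRecord_eq_zero_or_one ν ε₁ K k V with h | h <;> rw [h]
  · exact ⟨le_rfl, zero_le_one⟩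
  · exact ⟨zero_le_one, le_rfl⟩

/-- `0 ≤ χ^{(2.9),all} ≤ 1`. [cite: Balaban1987RG1, (2.9) p.266 (bookkeeping)] -/
theorem chiFix29AllOfRecord_mem_Icc (ν : Stage7Numerics) (ε₁ : ℝ) (K k : ℕ) (V : GaugeField (F.P K) k (SU N)) :
    chiFix29AllOfRecord F N ν ε₁ K k V ∈ Icc (0 : ℝ) 1 := by
  rcases chiFix29AllOfRecord_eq_zero_or_one ν ε₁ K k V with h | h <;> rw [h]
  · exact ⟨le_rfl, zero_le_one⟩
  · exact ⟨zero_le_one, le_rfl⟩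

/-- **`χ^{(2.9)}_k(V) = 1` iff every non-distinguished fluctuation variable is `ε₁`-small.** [cite: Balaban1987RG1, (2.9) p.266] -/
theorem chiFix29OfRecord_eq_one_iff (ν : Stage7Numerics) (ε₁ : ℝ) (K k : ℕ) (V : GaugeField (F.P K) k (SU N)) :
    chiFix29OfRecord F N ν ε₁ K k V = 1 ↔ ∀ b : PBond (F.P K) k, ¬ IsB0 b → fluctDevOfRecord F N ν K k V b < ε₁ := by
  unfold chiFix29OfRecord
  split_ifs with h
  · exact ⟨fun _ => h, fun _ => rfl⟩
  · exact ⟨fun h0 => absurd h0 zero_ne_one, fun h' => absurd h' h⟩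

/-- **`χ^{(2.9),all}_k(V) = 1` iff EVERY fluctuation variable is `ε₁`-small.** [cite: Balaban1987RG1, (2.9) p.266] -/
theorem chiFix29AllOfRecord_eq_one_iff (ν : Stage7Numerics) (ε₁ : ℝ) (K k : ℕ) (V : GaugeField (F.P K) k (SU N)) :
    chiFix29AllOfRecord F N ν ε₁ K k V = 1 ↔ ∀ b : PBond (F.P K) k, fluctDevOfRecord F N ν K k V b < ε₁ := by
  unfold chiFix29AllOfRecord
  split_ifs with h
  · exact ⟨fun _ => h, fun _ => rfl⟩
  · exact ⟨fun h0 => absurd h0 zero_ne_one, fun h' => absurd h' h⟩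

/-- The all-bonds cutoff is below the printed one (it restricts more variables): `χ^{(2.9),all} ≤ χ^{(2.9)}` (lit-balaban's `chiFluct_le_chiFluctPrinted`, on the fibre).
[cite: Balaban1987RG1, (2.9) p.266] -/
theorem chiFix29AllOfRecord_le (ν : Stage7Numerics) (ε₁ : ℝ) (K k : ℕ) (V : GaugeField (F.P K) k (SU N)) :
    chiFix29AllOfRecord F N ν ε₁ K k V ≤ chiFix29OfRecord F N ν ε₁ K k V := by
  rcases chiFix29AllOfRecord_eq_zero_or_one ν ε₁ K k V with h | h
  · rw [h]; exact (chiFix29OfRecord_mem_Icc ν ε₁ K k V).1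
  · have h' : chiFix29OfRecord F N ν ε₁ K k V = 1 :=
      (chiFix29OfRecord_eq_one_iff ν ε₁ K k V).2 fun b _ => (chiFix29AllOfRecord_eq_one_iff ν ε₁ K k V).1 h b
    rw [h, h']

/-- **THE RECORD'S `χ^{(2.9)}` IS lit-balaban's TYPED (2.9)** `B12SmallFieldDomain259.chiFluctPrinted ε₁` (product over `T^{(k)} ∖ {b₀(c)}`), evaluated at the
deviation profile `b ↦ |V′(b) − 1|` read on the fibre (an `ℝ`-valued bond field, `‖x‖ = x` for `x ≥ 0`) — no restatement of (2.9).
[cite: Balaban1987RG1, (2.9) p.266] -/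
theorem chiFix29OfRecord_eq_chiFluctPrinted (ν : Stage7Numerics) (ε₁ : ℝ) (K k : ℕ) (V : GaugeField (F.P K) k (SU N)) :
    chiFix29OfRecord F N ν ε₁ K k V =
      B12SmallFieldDomain259.chiFluctPrinted (P := F.P K) (k := k) (𝔤 := ℝ) ε₁ (fun b => fluctDevOfRecord F N ν K k V b) := by
  have hn : ∀ b : PBond (F.P K) k, ‖fluctDevOfRecord F N ν K k V b‖ = fluctDevOfRecord F N ν K k V b :=
    fun b => Real.norm_of_nonneg (fluctDevOfRecord_nonneg ν K k V b)
  have key : (∀ b : PBond (F.P K) k, (¬ ∃ c : PBond (F.P K) (k + 1), B12SmallFieldDomain259.b0 c = b) →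
        ‖fluctDevOfRecord F N ν K k V b‖ < ε₁) ↔ ∀ b : PBond (F.P K) k, ¬ IsB0 b → fluctDevOfRecord F N ν K k V b < ε₁ := by
    simp only [hn, IsB0]
  unfold chiFix29OfRecord B12SmallFieldDomain259.chiFluctPrinted
  by_cases h : ∀ b : PBond (F.P K) k, ¬ IsB0 b → fluctDevOfRecord F N ν K k V b < ε₁
  · rw [if_pos h, if_pos (key.2 h)]
  · rw [if_neg h, if_neg fun h' => h (key.1 h')]

/-- … and the all-bonds twin IS lit-balaban's `chiFluct ε₁` on the same profile. [cite: Balaban1987RG1, (2.9) p.266] -/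
theorem chiFix29AllOfRecord_eq_chiFluct (ν : Stage7Numerics) (ε₁ : ℝ) (K k : ℕ) (V : GaugeField (F.P K) k (SU N)) :
    chiFix29AllOfRecord F N ν ε₁ K k V =
      B12SmallFieldDomain259.chiFluct (P := F.P K) (k := k) (𝔤 := ℝ) ε₁ (fun b => fluctDevOfRecord F N ν K k V b) := by
  have hn : ∀ b : PBond (F.P K) k, ‖fluctDevOfRecord F N ν K k V b‖ = fluctDevOfRecord F N ν K k V b :=
    fun b => Real.norm_of_nonneg (fluctDevOfRecord_nonneg ν K k V b)
  have key : (∀ b : PBond (F.P K) k, ‖fluctDevOfRecord F N ν K k V b‖ < ε₁) ↔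
      ∀ b : PBond (F.P K) k, fluctDevOfRecord F N ν K k V b < ε₁ := by
    simp only [hn]
  unfold chiFix29AllOfRecord B12SmallFieldDomain259.chiFluct
  by_cases h : ∀ b : PBond (F.P K) k, fluctDevOfRecord F N ν K k V b < ε₁
  · rw [if_pos h, if_pos (key.2 h)]
  · rw [if_neg h, if_neg fun h' => h (key.1 h')]

/-- The fluctuation deviation at a bond is measurable in `V` AS SOON AS `W ↦ U_{k+1}(W)` is (group operations and `dist1` are measurable on `SU(N)`,
`RegularGaugeGroup`; the averaging of record is measurable).  DISPLAYED hypothesis ((H-U) species). [cite: Balaban1987RG1, (2.9) p.266 (bookkeeping)] -/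
theorem measurable_fluctDevOfRecord_of {ν : Stage7Numerics} {K k : ℕ} (hU : Measurable (Uk F N K (k + 1) ν.εreg)) (b : PBond (F.P K) k) :
    Measurable (fun V : GaugeField (F.P K) k (SU N) => fluctDevOfRecord F N ν K k V b) := by
  have hcrit : Measurable (fun V : GaugeField (F.P K) k (SU N) => critCfgOfRecord F N ν K k ((avOfRecord F N K k).avg V) b) :=
    (measurable_pi_apply b).comp ((measurable_critCfgOfRecord_of hU).comp (avOfRecord_measurable F N K k))
  have hV : Measurable (fun V : GaugeField (F.P K) k (SU N) => V b) := measurable_pi_apply b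
  unfold fluctDevOfRecord bdev
  exact RegularGaugeGroup.measurable_dist1.comp (hcrit.inv.mul hV)

/-- **`χ^{(2.9),all}_k` is measurable AS SOON AS `W ↦ U_{k+1}(W)` is.** [cite: Balaban1987RG1, (2.9) p.266 (bookkeeping)] -/
theorem measurable_chiFix29AllOfRecord_of {ν : Stage7Numerics} (ε₁ : ℝ) {K k : ℕ} (hU : Measurable (Uk F N K (k + 1) ν.εreg)) :
    Measurable (chiFix29AllOfRecord F N ν ε₁ K k) := by
  have hS : MeasurableSet {V : GaugeField (F.P K) k (SU N) | ∀ b : PBond (F.P K) k, fluctDevOfRecord F N ν K k V b < ε₁} := by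
    have h : {V : GaugeField (F.P K) k (SU N) | ∀ b : PBond (F.P K) k, fluctDevOfRecord F N ν K k V b < ε₁} =
        ⋂ b : PBond (F.P K) k, {V | fluctDevOfRecord F N ν K k V b < ε₁} := by
      ext V
      simp only [mem_setOf_eq, mem_iInter]
    rw [h]
    exact MeasurableSet.iInter fun b => measurableSet_lt (measurable_fluctDevOfRecord_of hU b) measurable_const
  unfold chiFix29AllOfRecord
  exact Measurable.ite hS measurable_const measurable_const

/-- **`χ^{(2.9)}_k` (as printed) is measurable AS SOON AS `W ↦ U_{k+1}(W)` is.** [cite: Balaban1987RG1, (2.9) p.266 (bookkeeping)] -/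
theorem measurable_chiFix29OfRecord_of {ν : Stage7Numerics} (ε₁ : ℝ) {K k : ℕ} (hU : Measurable (Uk F N K (k + 1) ν.εreg)) :
    Measurable (chiFix29OfRecord F N ν ε₁ K k) := by
  classical
  have hS : MeasurableSet {V : GaugeField (F.P K) k (SU N) | ∀ b : PBond (F.P K) k, ¬ IsB0 b → fluctDevOfRecord F N ν K k V b < ε₁} := by
    have h : {V : GaugeField (F.P K) k (SU N) | ∀ b : PBond (F.P K) k, ¬ IsB0 b → fluctDevOfRecord F N ν K k V b < ε₁} =
        ⋂ b : PBond (F.P K) k, {V | ¬ IsB0 b → fluctDevOfRecord F N ν K k V b < ε₁} := by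
      ext V
      simp only [mem_setOf_eq, mem_iInter]
    rw [h]
    refine MeasurableSet.iInter fun b => ?_
    by_cases hb : IsB0 b
    · have : {V : GaugeField (F.P K) k (SU N) | ¬ IsB0 b → fluctDevOfRecord F N ν K k V b < ε₁} = univ :=
        eq_univ_of_forall fun V h0 => absurd hb h0
      rw [this]
      exact MeasurableSet.univ
    · have : {V : GaugeField (F.P K) k (SU N) | ¬ IsB0 b → fluctDevOfRecord F N ν K k V b < ε₁} =
          {V | fluctDevOfRecord F N ν K k V b < ε₁} := by
        ext V
        simp only [mem_setOf_eq]
        exact ⟨fun h => h hb, fun h _ => h⟩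
      rw [this]
      exact measurableSet_lt (measurable_fluctDevOfRecord_of hU b) measurable_const
  unfold chiFix29OfRecord
  exact Measurable.ite hS measurable_const measurable_const

variable (F N)

/-! ## §3. The β-slot re-keying and the THRESHOLD HIERARCHY: on the support of the fluctuation cutoff the sharp domain indicator of record is `1` -/

/-- **THE (2.9)-KEYED β-SLOT χ** `chiFixed29 ν ε₁ : (K : ℕ) → (ℕ → ℝ) → (k : ℕ) → Density (F.P K) k (SU N)` — the TYPE of def-B's χ argument (`effActionHT`) and of
`chi7`∕`chiFixed7`; the coupling sequence is IGNORED (print's alternative threshold `(g_k∕γ_k)ε₁` of p. 266 is NOT adopted, as for `chiFixed7`).  OFFERED: no record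
reads it here. [cite: Balaban1987RG1, (0.19) p.256 and (2.9) p.266] -/
def chiFixed29 (ν : Stage7Numerics) (ε₁ : ℝ) : (K : ℕ) → (ℕ → ℝ) → (k : ℕ) → Density (F.P K) k (SU N) :=
  fun K _ k => chiFix29OfRecord F N ν ε₁ K k

variable {F N}

/-- Coupling-blind by typing (`rfl`). [cite: Balaban1987RG1, (2.9) p.266 (bookkeeping)] -/
theorem chiFixed29_flowBlind (ν : Stage7Numerics) (ε₁ : ℝ) (K : ℕ) (g g' : ℕ → ℝ) : chiFixed29 F N ν ε₁ K g = chiFixed29 F N ν ε₁ K g' := rfl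

/-- Unfolding at a run (`rfl`). [cite: Balaban1987RG1, (2.9) p.266 (bookkeeping)] -/
theorem chiFixed29_apply (ν : Stage7Numerics) (ε₁ : ℝ) (K : ℕ) (g : ℕ → ℝ) (k : ℕ) : chiFixed29 F N ν ε₁ K g k = chiFix29OfRecord F N ν ε₁ K k := rfl

/-- **THE THRESHOLD-HIERARCHY LEMMA (all-bonds form)** — the group algebra behind [III] p. 265 l. 31–32 «on Ω^∼_{k+1} the functions χ_{Λ_k} and χ_k are equal
to 1» and [IV] Prop 1 (1.78): if every fluctuation variable of `V` is `ε₁`-small (`χ^{(2.9),all}_k(V) = 1`), the critical configuration over `V̄` has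
`δ`-small plaquettes (Prop 2 [12] for regular `V̄` — a HYPOTHESIS here) and the thresholds are ordered, `δ + 4ε₁ ≤ ε₀`, then `V` lies in the small-field
DOMAIN of record «|∂V − 1| < ε₀» (the tree's `dist1_plaqHol_le_add` + `plaqDev_le_four_mul`: `|∂V − 1| ≤ |∂V^{(k)} − 1| + Σ_{b⊂∂p}|V^{(k)}(b)⁻¹V(b) − 1|`).
[cite: Balaban1988Convergent, p.265; Balaban1989LargeFieldI, Prop. 1 (1.78) p.194] -/
theorem mem_domAltOfRecord_of_chiFix29All_eq_one {ν : Stage7Numerics} {ε₁ δ : ℝ} {K k : ℕ} {V : GaugeField (F.P K) k (SU N)}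
    (hχ : chiFix29AllOfRecord F N ν ε₁ K k V = 1)
    (hcrit : PlaqSmall δ (critCfgOfRecord F N ν K k ((avOfRecord F N K k).avg V)))
    (hord : δ + 4 * ε₁ ≤ ν.ε₀) : V ∈ domAltOfRecord F N ν K k := by
  rw [mem_domAltOfRecord_iff]
  intro p
  set V₀ := critCfgOfRecord F N ν K k ((avOfRecord F N K k).avg V)
  have hb : ∀ b, dist1 (bdev V V₀ b) ≤ ε₁ := fun b => le_of_lt ((chiFix29AllOfRecord_eq_one_iff ν ε₁ K k V).1 hχ b)
  calc dist1 (GaugeField.plaqHol V p) ≤ dist1 (GaugeField.plaqHol V₀ p) + plaqDev V V₀ p := dist1_plaqHol_le_add V V₀ p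
    _ < δ + 4 * ε₁ := add_lt_add_of_lt_of_le (hcrit p) (plaqDev_le_four_mul hb p)
    _ ≤ ν.ε₀ := hord

/-- Hence the sharp domain indicator of record is `1` there: `chiFixAltOfRecord ν K k V = 1`. [cite: Balaban1988Convergent, p.265] -/
theorem chiFixAltOfRecord_eq_one_of_chiFix29All_eq_one {ν : Stage7Numerics} {ε₁ δ : ℝ} {K k : ℕ} {V : GaugeField (F.P K) k (SU N)}
    (hχ : chiFix29AllOfRecord F N ν ε₁ K k V = 1)
    (hcrit : PlaqSmall δ (critCfgOfRecord F N ν K k ((avOfRecord F N K k).avg V)))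
    (hord : δ + 4 * ε₁ ≤ ν.ε₀) : chiFixAltOfRecord F N ν K k V = 1 :=
  (chiFixAltOfRecord_eq_one_iff_mem ν K k V).2 (mem_domAltOfRecord_of_chiFix29All_eq_one hχ hcrit hord)

/-- **PRODUCT FORM — THE DOMAIN INDICATOR OF RECORD IS INVISIBLE ON THE SUPPORT OF THE FLUCTUATION CUTOFF**: pointwise
`χ^{dom}_k(V) · χ^{(2.9),all}_k(V) = χ^{(2.9),all}_k(V)` under the displayed Prop-2 smallness of the critical configuration and the threshold ordering — the
mechanism by which print's small-field terms never integrate an old `χ_k` across a fibre ([III] p. 268 l. 6–9, p. 269 l. 10–12).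
[cite: Balaban1988Convergent, pp.265–269] -/
theorem chiFixAltOfRecord_mul_chiFix29All {ν : Stage7Numerics} {ε₁ δ : ℝ} {K k : ℕ} (V : GaugeField (F.P K) k (SU N))
    (hcrit : PlaqSmall δ (critCfgOfRecord F N ν K k ((avOfRecord F N K k).avg V)))
    (hord : δ + 4 * ε₁ ≤ ν.ε₀) :
    chiFixAltOfRecord F N ν K k V * chiFix29AllOfRecord F N ν ε₁ K k V = chiFix29AllOfRecord F N ν ε₁ K k V := by
  rcases chiFix29AllOfRecord_eq_zero_or_one ν ε₁ K k V with h | h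
  · rw [h, mul_zero]
  · rw [h, mul_one, chiFixAltOfRecord_eq_one_of_chiFix29All_eq_one h hcrit hord]

/-- **PRINTED FORM, MODULO THE p. 266–267 RIDER**: with (2.9) as printed (the `b₀(c)`-variables unrestricted by χ) the same conclusion holds once the excluded
variables obey the induced restriction «with the constant ε₁ replaced by O(ε₁)» ([I] p. 266–267, lit-balaban's `B12B0Restriction267`; a consequence of the
constraint on the fibre — a displayed HYPOTHESIS `hb0` here) and `δ + 4·max(ε₁, ε₁′) ≤ ε₀`. [cite: Balaban1987RG1, (2.9) p.266 and p.267] -/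
theorem mem_domAltOfRecord_of_chiFix29_eq_one {ν : Stage7Numerics} {ε₁ ε₁' δ : ℝ} {K k : ℕ} {V : GaugeField (F.P K) k (SU N)}
    (hχ : chiFix29OfRecord F N ν ε₁ K k V = 1)
    (hb0 : ∀ b : PBond (F.P K) k, IsB0 b → fluctDevOfRecord F N ν K k V b ≤ ε₁')
    (hcrit : PlaqSmall δ (critCfgOfRecord F N ν K k ((avOfRecord F N K k).avg V)))
    (hord : δ + 4 * max ε₁ ε₁' ≤ ν.ε₀) : V ∈ domAltOfRecord F N ν K k := by
  rw [mem_domAltOfRecord_iff]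
  intro p
  set V₀ := critCfgOfRecord F N ν K k ((avOfRecord F N K k).avg V)
  have hb : ∀ b, dist1 (bdev V V₀ b) ≤ max ε₁ ε₁' := by
    intro b
    by_cases h0 : IsB0 b
    · exact (hb0 b h0).trans (le_max_right _ _)
    · exact (le_of_lt ((chiFix29OfRecord_eq_one_iff ν ε₁ K k V).1 hχ b h0)).trans (le_max_left _ _)
  calc dist1 (GaugeField.plaqHol V p) ≤ dist1 (GaugeField.plaqHol V₀ p) + plaqDev V V₀ p := dist1_plaqHol_le_add V V₀ p
    _ < δ + 4 * max ε₁ ε₁' := add_lt_add_of_lt_of_le (hcrit p) (plaqDev_le_four_mul hb p)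
    _ ≤ ν.ε₀ := hord

variable (F N)

/-! ## §4. OFFERED: the χ-generic β-input of the (0.19) recursion and the (2.9)-keyed β-version provisos (displayed, never asserted) -/

/-- **The β-input density of the (0.19) recursion for an ARBITRARY χ family** `χ : (K : ℕ) → (ℕ → ℝ) → (k : ℕ) → Density`: `χ_k · exp[−GF/g_k² + A_k]` with
`A_k` def-B's generic effective action over the transport family `T` and the SAME χ (`effActionHT`).  At `χ := chiFixed7 θ.ν` it is the density of def-T's
`HasContTransportAlongβ` ∕ FILE 1's `HasContTransportAlongOn` (`rfl`). [cite: Balaban1987RG1, (0.19) p.255] -/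
def betaInputOfRecord (T : Transport F N) (χ : (K : ℕ) → (ℕ → ℝ) → (k : ℕ) → Density (F.P K) k (SU N)) (K : ℕ) (g : ℕ → ℝ) (k : ℕ) :
    Density (F.P K) k (SU N) :=
  integrand (χ K g k) (gfOfRecord F N K k) (g k) (effActionHT F N T χ K g k)

/-- **χ-GENERIC ON-DOMAIN β-VERSION PROVISO** along a transport family `T`, a χ family and a domain family: at every torus, history and step `k < K` the
β-input has a transform of record with a version continuous ON `dom K g (k+1)`.  (The numerics enter only through `χ` and `dom`.)
[cite: Balaban1987RG1, (0.13) p.254 and (0.19) p.255] -/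
def HasContTransportAlongOnχ (T : Transport F N) (χ : (K : ℕ) → (ℕ → ℝ) → (k : ℕ) → Density (F.P K) k (SU N))
    (dom : (K : ℕ) → (ℕ → ℝ) → (k : ℕ) → Set (PBond (F.P K) k → SU N)) : Prop :=
  ∀ (K : ℕ) (g : ℕ → ℝ) (k : ℕ), k < K → HasContTransportOn F N K k (betaInputOfRecord F N T χ K g k) (dom K g (k + 1))

variable {F N}

/-- At `χ := chiFixed7 θ.ν` the χ-generic proviso IS FILE 1's `Stage8Params.HasContTransportAlongOn θ` (`Iff.rfl`). [cite: Balaban1987RG1, (0.19) p.255 (bookkeeping)] -/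
theorem Stage8Params.hasContTransportAlongOn_iff_chi (θ : Stage8Params F N) (T : Transport F N)
    (dom : (K : ℕ) → (ℕ → ℝ) → (k : ℕ) → Set (PBond (F.P K) k → SU N)) :
    θ.HasContTransportAlongOn F N T dom ↔ HasContTransportAlongOnχ F N T (chiFixed7 F N θ.ν) dom := Iff.rfl

/-- At `χ := chiFixed7 θ.ν`, `T := TcOfRecord`, `dom := univ` it is def-T's everywhere proviso `Stage8Params.HasContTransportAlong` (= ₁₀'s `contT`).
[cite: Balaban1987RG1, (0.13) p.254 (bookkeeping)] -/
theorem Stage8Params.hasContTransportAlong_iff_chi (θ : Stage8Params F N) :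
    θ.HasContTransportAlong ↔ HasContTransportAlongOnχ F N (TcOfRecord F N) (chiFixed7 F N θ.ν) fun _ _ _ => univ := by
  constructor
  · intro h K g k hk
    exact hasContTransportAt_iff_on_univ.1 (h K g k hk)
  · intro h K g k hk
    exact hasContTransportAt_iff_on_univ.2 (h K g k hk)

variable (F N)

/-- **THE (2.9)-KEYED EVERYWHERE PROVISO** (offered; the analogue of ₁₀'s `contT` with print's fluctuation cutoff in the χ slot): along `T`, at threshold `ε₁`,
every β-input `χ^{(2.9)}_k·e^{−GF/g_k²+A_k}` has a transform of record admitting an everywhere-continuous version.  NOT in print either (off the regular `W`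
print says nothing); displayed for comparison only. [cite: Balaban1987RG1, (2.1) p.265 and (2.9) p.266] -/
def Stage8Params.HasContTransportAlong29 (θ : Stage8Params F N) (T : Transport F N) (ε₁ : ℝ) : Prop :=
  HasContTransportAlongOnχ F N T (chiFixed29 F N θ.ν ε₁) fun _ _ _ => univ

/-- **THE (2.9)-KEYED ON-DOMAIN PROVISO** (offered): along `T`, at threshold `ε₁`, every β-input `χ^{(2.9)}_k·e^{−GF/g_k²+A_k}` has a transform of record with a
version continuous ON def-R's FIRST-form small-field domain of the next step `domOfRecord θ.ν K (k+1)` = print's «W regular: U_{k+1}(W) ∈ U_{k+1}(ε₀)» ((2.1)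
p. 265, (1.2) p. 260).  Its small-field CONTENT is [I] (2.10) p. 267 + §3 (the step is an integral over a W-INDEPENDENT domain with an integrand analytic in
(B₁, W)) ∕ [III] (2.23)(ii) — MODULO the identification of the abstract disintegration transform of record with that parametrised integral (the Jacobian face
of (0.4), print's unproved δ-calculus «∫dV δ(V̄W⁻¹)… = ∫dB′ σ(B′) δ(Q(B′))…»; located note §4 (F1)).  DISPLAYED, never asserted.
[cite: Balaban1987RG1, (2.1) p.265, (2.9) p.266, (2.10) p.267] -/
def Stage8Params.HasContTransportAlongDom29 (θ : Stage8Params F N) (T : Transport F N) (ε₁ : ℝ) : Prop :=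
  HasContTransportAlongOnχ F N T (chiFixed29 F N θ.ν ε₁) fun K _ k => domOfRecord F N θ.ν K k

variable {F N}

/-- The offered everywhere form implies the offered on-domain form (on every domain family). [cite: Balaban1987RG1, (0.13) p.254 (bookkeeping)] -/
theorem Stage8Params.HasContTransportAlong29.dom {θ : Stage8Params F N} {T : Transport F N} {ε₁ : ℝ} (h : θ.HasContTransportAlong29 F N T ε₁) :
    θ.HasContTransportAlongDom29 F N T ε₁ := by
  intro K g k hk
  have h' := h K g k hk
  obtain ⟨f, hf, hae⟩ := h'
  exact ⟨f, hf.mono (subset_univ _), ae_restrict_of_ae (by rwa [Measure.restrict_univ] at hae)⟩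

end Literature.MathematicalPhysics.QuantumFieldTheory.Balaban1983to89.Node00

end
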